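import Summits.RiemannHypothesis.RiemannHypothesis.Theorems.HandoffDecompositionConsequences
import HarnessLib

/-!
# The HYBRID target of the handoff decomposition: a certified rung at a prime `q₀` plus the increment for all primes `≥ q₀`

Cell `rh-explicit`, TRACK «HANDOFF», seat handoff-theory-1 (definitions + logic), gen2.  Companion text:
`HOME/handoff/HANDOFF-STATEMENT.md` §I.4 (v1.2).  Builds on this seat's `HandoffDecomposition{,Consequences}.lean`.

HONEST FRAMING.  Nothing here is a step towards RH.  `HandoffDecompositionConsequences.exists_forall_handoffStep` (the
VACUITY TRAP) says that the tail form `∃ q₀, ∀ primes q ≥ q₀, HandoffStep q` of the increment is a theorem of excluded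
middle, hence not a target.  This file records the precise sense in which an asymptotic / uniform-in-`q` proof of the
increment IS nevertheless worth having: paired with Weil positivity AT THE SAME `q₀` — the object the cell's certified
ladder produces (`WeilPositivityOn ((log q₀)/2)` = `H(q₀⁻)`, today a THEOREM only for `q₀ ≤ 3` and CERTIFIED data to
`q₀ = 19`) — it is RH:

* `weilPositivityOn_nextPrime_of_rung` — induction along the primes from a rung at the prime `q₀`;
* `riemannHypothesis_iff_rung_and_forall_ge_handoffStep` — for every prime `q₀`:
  `RH ↔ (WeilPositivityOn((log q₀)/2) ∧ ∀ primes q ≥ q₀, HandoffStep q)`.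
  The `q₀` of the increment proof and the `q₀` of the certificate must COINCIDE; an ineffective `q₀` is worthless
  (that is the vacuity trap again), an effective one converts certified rungs below it into RH.
* `riemannHypothesis_iff_forall_lt_handoffH_and_forall_ge_handoffStep` — the same with the finite part written as the
  ladder `∀ primes q < q₀, H(q)` (`q₀ ≥ 3`).

References: Bombieri, Rend. Lincei (9) 11 (2000) Thm 2 [Bombieri2000Weil]; Yoshida 1992 Prop. 6 [Yoshida1992HermitianForms].
-/

set_option linter.dupNamespace false  -- the mandated namespace repeats `RiemannHypothesis`

noncomputable section

open Set Literature.NumberTheory.LFunctions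

namespace Summit.RiemannHypothesis.RiemannHypothesis.Theorems.HandoffDecomposition

variable {q₀ : ℕ}

/-- **Induction along the primes from a rung.**  If `q₀` is prime, Weil positivity holds on `C((log q₀)/2)`, and the
increment `HandoffStep q` holds for every prime `q ≥ q₀`, then Weil positivity holds on `C((log n⁺)/2)` for every
`n ≥ q₀` (`n⁺ = nextPrime n`). [cite: Yoshida1992HermitianForms, Prop. 6 (thresholds); induction = this track] -/
theorem weilPositivityOn_nextPrime_of_rung (hq₀ : q₀.Prime) (hW : WeilPositivityOn (Real.log q₀ / 2))
    (h : ∀ q : ℕ, q.Prime → q₀ ≤ q → HandoffStep q) :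
    ∀ n : ℕ, q₀ ≤ n → WeilPositivityOn (Real.log (nextPrime n) / 2) := by
  intro n hn
  induction n with
  | zero => exact absurd (Nat.le_zero.mp hn) hq₀.ne_zero
  | succ m ih =>
    rcases Nat.lt_or_ge m q₀ with hlt | hge
    · -- `m < q₀ ≤ m + 1`, so `m + 1 = q₀`: the rung itself feeds the first step
      have heq : m + 1 = q₀ := le_antisymm hlt hn
      rw [heq]
      exact (handoffH_iff_weilPositivityOn hq₀).1 (h q₀ hq₀ le_rfl hW)
    · by_cases hp : (m + 1).Prime
      · have h1 : WeilPositivityOn (Real.log ((m + 1 : ℕ) : ℝ) / 2) := by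
          have := ih hge
          rwa [nextPrime_eq_succ_of_prime hp] at this
        exact (handoffH_iff_weilPositivityOn hp).1 (h _ hp (le_trans hge (Nat.le_succ m)) h1)
      · rw [nextPrime_succ_of_not_prime hp]
        exact ih hge

/-- **THE HYBRID TARGET.**  For every prime `q₀`:
`RH ↔ (WeilPositivityOn((log q₀)/2) ∧ ∀ primes q ≥ q₀, HandoffStep q)` — a CERTIFIED rung at `q₀` (the ladder's
object `H(q₀⁻)`) together with the increment proved for all primes from the SAME `q₀` on is the Riemann hypothesis;
conversely RH gives both.  Contrast `exists_forall_handoffStep`: with an ineffective `q₀` the second conjunct alone is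
contentless. [cite: Bombieri2000Weil, Thm. 2; this track (theory-1 gen2)] -/
theorem riemannHypothesis_iff_rung_and_forall_ge_handoffStep (hq₀ : q₀.Prime) :
    Summit.RiemannHypothesis ↔
      (WeilPositivityOn (Real.log q₀ / 2) ∧ ∀ q : ℕ, q.Prime → q₀ ≤ q → HandoffStep q) := by
  constructor
  · intro hRH
    refine ⟨?_, fun q hq _ _ ↦ handoffH_of_riemannHypothesis hRH hq⟩
    refine MotivicDoor.Rungs.rung_of_riemannHypothesis hRH ?_
    have := Real.log_pos (show (1 : ℝ) < q₀ by exact_mod_cast hq₀.one_lt)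
    positivity
  · rintro ⟨hW, h⟩
    rw [riemannHypothesis_iff_forall_handoffH]
    intro q hq
    rw [handoffH_iff_weilPositivityOn hq]
    rcases Nat.lt_or_ge q q₀ with hlt | hge
    · -- below the rung: `q⁺ ≤ q₀`
      refine hW.mono ?_
      have h1 : (nextPrime q : ℝ) ≤ q₀ := by exact_mod_cast nextPrime_le hq₀ hlt
      have h0 : (0 : ℝ) < nextPrime q := by exact_mod_cast (nextPrime_prime q).pos
      linarith [Real.log_le_log h0 h1]
    · exact weilPositivityOn_nextPrime_of_rung hq₀ hW h q hge

/-- The same with the finite part written as the LADDER below `q₀`: for a prime `q₀ ≥ 3`,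
`RH ↔ ((∀ primes q < q₀, H q) ∧ ∀ primes q ≥ q₀, HandoffStep q)` (the last rung below `q₀` is `H(q₀⁻) =
WeilPositivityOn((log q₀)/2)`). [cite: Bombieri2000Weil, Thm. 2; this track (theory-1 gen2)] -/
theorem riemannHypothesis_iff_forall_lt_handoffH_and_forall_ge_handoffStep (hq₀ : q₀.Prime) (h3 : 3 ≤ q₀) :
    Summit.RiemannHypothesis ↔
      ((∀ q : ℕ, q.Prime → q < q₀ → HandoffH q) ∧ ∀ q : ℕ, q.Prime → q₀ ≤ q → HandoffStep q) := by
  constructor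
  · intro hRH
    exact ⟨fun q hq _ ↦ handoffH_of_riemannHypothesis hRH hq,
      fun q hq _ _ ↦ handoffH_of_riemannHypothesis hRH hq⟩
  · rintro ⟨hlt, hge⟩
    -- the previous prime `p` of `q₀` has `nextPrime p = q₀`, so `H p` is the rung at `q₀`
    obtain ⟨p, hp⟩ := Handoff.exists_consecutivePrimes_of_prime hq₀ h3
    have hH : HandoffH p := hlt p hp.1 hp.2.2.1
    have hW : WeilPositivityOn (Real.log q₀ / 2) := by
      have := (handoffH_iff_weilPositivityOn hp.1).1 hH
      rwa [nextPrime_eq_of_consecutivePrimes hp] at this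
    exact (riemannHypothesis_iff_rung_and_forall_ge_handoffStep hq₀).2 ⟨hW, hge⟩

end Summit.RiemannHypothesis.RiemannHypothesis.Theorems.HandoffDecomposition

end
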